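import Literature.MathematicalPhysics.QuantumFieldTheory.Balaban1983to89.B8SectEKLevelFamilyBase

/-!
# `Balaban1983to89.B8SectEKLevelFamilyHc` — [Balaban1985RegularSpaces] Sect. E pp. 95–97 → Prop. 5 (1.107): THE SECT. E CORRECTION `H_c` OF
# `λ′ = λ + H_cλ` ((1.113)) WITH ITS EIGHT JOIN BINDERS, FOR AN ABSTRACT REMAINDER FAMILY AND AN INHOMOGENEOUS TARGET — the letter `Hc` that
# JOIN-A∕B (`B8Prop5GaugeParamKLevel.gaugeParam_kLevel`, `B8Prop5JoinHFP.hFP_kLevel`, the cell's restriction-agnostic `hFP_kLevel_agnostic_RD`)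
# consume through `hc0 hc1 hc2 hcL0 hcL1 hcL2 hcsa hcsupp`, built as `H_c λ := i·H′(t̂ − D′(−iλ + H′t̂))` from the family `D′` of
# `B8SectEKLevelFamily` (remainder `Cfam j`, rows (1.121)∕(1.125) displayed) and a displayed skew datum `t̂ : 𝔅_k → 𝔤` (the value the
# linearised restriction functional is to take — `t̂ = 0` is print's case (1.114) «Q′(λ − H′D′(λ)) = Q′λ» with `Q′λ = 0`)

statement-level skeleton of published theorems with citation tags; proofs where landed; nothing here is a claim about the Yang–Mills mass gap

T. Bałaban, *Spaces of regular gauge field configurations on a lattice and gauge fixing conditions*, Commun. Math. Phys. **99** (1985)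
75–102 `[Balaban1985RegularSpaces]` ("B8"; printed page = PDF page + 74), pp. 91–97 [PDF 17–23].  PDF held:
`paper:balaban1985-cmp99-regular-spaces-gauge-fixing`.  STATUS: published, refereed.

THE PRINTED TEXT (p. 92 [PDF 18]): «In the next section we will prove that for α₃, α₄ sufficiently small there exists a function D′(u₁, λ) such
that the change of variables λ → λ − H′D′(u₁, λ) transforms the function Q′(u₁, λ) into Q′λ. The function D′(u₁, λ) is analytic in λ, defined
on a set of λ satisfying (1.77) with ½α₄ instead of α₄, and is bounded by C′₂(α₃ + α₄)α₄ …»; (p. 95) «λ′ = λ − H′D′(λ) (1.113) changes the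
function Q′(λ′) into the linear function Q′λ»; (p. 97) «This solution is an analytic function of λ … |D′(λ)| = |C′(λ − H′D′(λ))| < C′₂(α₃ + α₄)α₄.»

## WHY THIS FILE (cell `ym3-torus`, HUMAN RULING D-0037 — YM₃ on T³ is ladder rung R3, not the Clay problem; seat `ym-ust-19936-w8` g0∕s2,
★★OWNER ym3-torus-plan g26 ACK 45 (b) row «J4b», LEAD-H `ym-ust-19200-w5` g4 T2♭-PLAN v1.1 #46 J4; `--supports stmt-QuantumFields-19200`)

The route's P1♭ `core` asks [B8] Prop. 5 at the top level with the cell's normalisation (o) in place of print's restriction (1.29)_k.  Prop. 5's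
k-level machine in the tree is restriction-AGNOSTIC except where the Sect. E correction is BUILT (JOIN-C `B8Prop5JoinSectE.exists_Dprime_map` reads
[3]'s concrete remainder `Cnl`) — the cell's J4c (`hFP_kLevel_agnostic_RD`, seat `ym-ust-19936-w3` g6) takes `Hc` as a free letter with the eight
binders below.  THIS FILE supplies that letter for ANY remainder family `Cfam` (instance of record: `Cnl` at the levels `j < k`, the (o)-remainder
at `j = k`, rows from the cell's tower file) and ANY skew target `t̂` (the inhomogeneous (o) datum), with the sizes `h₀ = h₁ = B′₀(Cb + ‖t̂‖)`,
`h₂ = B′₂(Cb + ‖t̂‖)`, moduli `l₀ = l₁ = 2B′₀·Cl`, `l₂ = 2B′₂·Cl`, reality and support, AND the TRANSFER clause exposing, for every `λ_s` in the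
¼α₄-ball, the solution `X_s = D′(−iλ_s + H′t̂)` with `−i(λ_s + H_cλ_s) = −iλ_s + H′t̂ − H′X_s` — from which a consumer holding a decomposition
`Qfull j μ y = Qlin j μ y + Cfam j μ y` reads `Qfull j (−iλ′) y = Qlin j (−iλ_s) y + t̂(j, y)` by `B8SectEKLevelFamily.eq1114_of_fixedPoint_kLevel_fam`.

## WHAT IS CERTIFIED HERE (kernel; theorems only; no `sorry`, no `def`, no `instance`, no `notation`)

* (sibling `B8SectEKLevelFamilyBase`, imported: §1 the shifted base point `−iλ_s + H′t̂` in (1.119); §2 `D′` there — existence, Lipschitz, reality.)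
* §3 ★ `exists_Hc_of_family` — the letter `Hc` with the eight JOIN binders and the transfer clause.

## HONEST SCOPE

Assembly over `B8SectEKLevelFamily(Lipschitz)` and JOIN-C's public bookkeeping; every analytic input is a displayed hypothesis (the family rows
(1.121)∕(1.125) and covariance, [4]'s `H′` letters (1.92)₀,₁,₂ ∕ range ∕ covariance, the target's size and skewness).  Nothing here discharges
those rows, nothing here is Prop. 5 or Theorem 4, nothing continuum ∕ ℝ⁴ ∕ OS ∕ mass-gap ∕ Clay.  2026-08-28.
-/

noncomputable section

open NormedSpace
open Complex (I)

namespace Literature.MathematicalPhysics.QuantumFieldTheory.Balaban1983to89.B8SectEKLevelFamilyHc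

open B7Prop1Explicit B7Prop1Local
open B7Eq170Flat (cj cj_apply cj_add)
open B8Ineq130 (tlo thi)
open B8Ineq132 (covDerivFwd)
open B8Eq138LandauZd (covLap)
open B8Eq1122Concrete (cjDiff_sub)
open B8Eq1123Concrete (cj_smul_complex)
open B8Eq1117Concrete (XSpace)
open B8Eq1117KLevel (dom120_of_119_tower)
open B8Eq151V2Divergence (covDerivFwd_smul)
open B8LambdaSpaceKLevel (wt lamSubK lamOf norm_lamOf_le norm_cjDiff_lamOf_le lamOf_sub ext_of_lamOf)
open B8Prop5ContractionKLevel (Bd2)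
open B8Prop5KLevelLetters (covLap_sub)
open B8Prop5JoinSectE (cjDiff_le_of_weighted covLap_smul ball_sub_119 ball_diff_modulus hH1_tower)
open B8SectEKLevelFamily (exists_Dprime_kLevel_fam)
open B8SectEKLevelFamilyLipschitz (Dprime_lipschitz_kLevel_fam)
open B8SectEKLevelFamilyBase (base_sub_119 familyE_exists familyE_lipschitz familyE_real)

-- `Site` alone could resolve to the torus sites of `Setup.lean`; re-export the `ℤ^d` sites of `B7Prop1Explicit`.
export B7Prop1Explicit (Site)

variable {d : ℕ} {𝔸 : Type*} [CStarAlgebra 𝔸]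

/-! ## §0 Bookkeeping: the scalars `±i` -/

section Bookkeeping

/-- `‖i·a‖ = ‖a‖`. [folklore] -/
private theorem norm_I_smul (a : 𝔸) : ‖I • a‖ = ‖a‖ := by
  rw [norm_smul, Complex.norm_I, one_mul]

/-- `(i·a)⋆ = −i·a⋆`. [folklore] -/
private theorem star_I_smul (a : 𝔸) : star (I • a) = (-I) • star a := by
  rw [star_smul, Complex.star_def, Complex.conj_I]

/-- For skew `a` (`a⋆ = −a`), `i·a` is Hermitian. [folklore] -/
private theorem isSelfAdjoint_I_smul_of_skew {a : 𝔸} (ha : star a = -a) : IsSelfAdjoint (I • a) := by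
  rw [IsSelfAdjoint, star_I_smul, ha, smul_neg, neg_smul, neg_neg]

end Bookkeeping

/-! ## §3 The letter `Hc` with its eight JOIN binders and the transfer clause -/

section Hc

variable {L k : ℕ} {η : ℝ} {Ω Λs : ℕ → Set (Site d)} {Eb : ℕ → Set (Site d × Fin d)} {U₀ : Site d → Fin d → 𝔸ˣ}
  {α₄ B₀' B₂' Cb Cl : ℝ} {Cfam : ℕ → (Site d → 𝔸) → Site d → 𝔸}

/-- **THE SECT. E CORRECTION `H_c λ := i·H′(t̂ − D′(−iλ + H′t̂))` WITH ITS EIGHT JOIN BINDERS, FOR AN ABSTRACT REMAINDER FAMILY AND A SKEW TARGET.**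
LETTERS: `H′` of [4] with (1.92)₀,₁,₂ (`hH0`, `Eb`-weighted `hH1`, `hH2` in `Bd2` form), Dirichlet range `hHsupp` and covariance `hHequiv`; the
family `Cfam` with (1.121) `hC121` (constant `Cb`), (1.125) `hC125` (modulus `Cl`, in the Lʲ-weighted-gradient currency) and covariance `hCreal`
on the (1.120)-set of every tower; print's smallness `Cb ≤ α₄∕(2B′₀)`, `Cl·B′₀ ≤ ½`; a target `t̂` with `B′₀‖t̂‖ < ¼α₄`, skew.  CONCLUSION: a map `Hc`
obeying JOIN-A∕B's `hc0 hc1 hc2` (sizes `B′₀(Cb + ‖t̂‖)`, `B′₀(Cb + ‖t̂‖)`, `B′₂(Cb + ‖t̂‖)`), `hcL0 hcL1 hcL2` (moduli `2B′₀Cl`, `2B′₀Cl`, `2B′₂Cl`),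
`hcsa`, `hcsupp` on the ¼α₄-ball, and the TRANSFER clause: for every `s` in the ball an `X` in Sect. E's ball with `‖X‖ ≤ Cb`, zero off `𝔅_k`,
solving (1.117) at the base point `−iλ_s + H′t̂`, with `Hc λ_s = i·H′(t̂ − X)` and `−i(λ_s + H_cλ_s) = −iλ_s + H′t̂ − H′X` ((1.113) for the inverse
pair, (a″) order). [cite: Balaban1985RegularSpaces, (1.113)–(1.121) pp.95–97, (1.92) p.91, (1.102) p.93, Prop. 5 (1.107)–(1.108) p.94] -/
theorem exists_Hc_of_family (hL : 1 ≤ L) (hη : 0 < η) (H' : XSpace d k 𝔸 →ₗ[ℂ] (Site d → 𝔸))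
    (hα₄ : 0 < α₄) (hB : 0 < B₀') (hB₂ : 0 ≤ B₂') (hCb : 0 ≤ Cb) (hCl : 0 ≤ Cl)
    (hEbT : ∀ j, j ≤ k → ∀ y ∈ Λs j, ∀ (x : Site d) (κ : Fin d), InBox (tlo L y j) (thi L y j) x →
      InBox (tlo L y j) (thi L y j) (x + e κ) → (x, κ) ∈ Eb j)
    (hH0 : ∀ (X : XSpace d k 𝔸) (x : Site d), ‖H' X x‖ ≤ B₀' * ‖X‖)
    (hH1 : ∀ j, j ≤ k → ∀ (X : XSpace d k 𝔸), ∀ p ∈ Eb j, wt L η j * ‖covDerivFwd η U₀ p.2 (H' X) p.1‖ ≤ B₀' * ‖X‖)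
    (hH2 : ∀ X : XSpace d k 𝔸, Bd2 L η k Ω (covLap η U₀ (H' X)) (B₂' * ‖X‖))
    (hHsupp : ∀ (X : XSpace d k 𝔸) (x : Site d), x ∉ Ω 0 → H' X x = 0)
    (hHequiv : ∀ X Y : XSpace d k 𝔸, (∀ p, Y p = -star (X p)) → ∀ x, H' Y x = -star (H' X x))
    (hC121 : ∀ j, j ≤ k → ∀ y ∈ Λs j, ∀ μ : Site d → 𝔸,
      (∀ x : Site d, InBox (tlo L y j) (thi L y j) x → ‖μ x‖ < α₄) →
      (∀ (x : Site d) (κ : Fin d), InBox (tlo L y j) (thi L y j) x → InBox (tlo L y j) (thi L y j) (x + e κ) →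
        ‖cj (U₀ x κ) (μ (x + e κ)) - μ x‖ < α₄ * ((L : ℝ) ^ j)⁻¹) →
      ‖Cfam j μ y‖ ≤ Cb)
    (hC125 : ∀ j, j ≤ k → ∀ y ∈ Λs j, ∀ (μ₁ μ₂ : Site d → 𝔸) (m : ℝ), 0 ≤ m →
      (∀ x : Site d, InBox (tlo L y j) (thi L y j) x → ‖μ₁ x‖ < α₄) →
      (∀ (x : Site d) (κ : Fin d), InBox (tlo L y j) (thi L y j) x → InBox (tlo L y j) (thi L y j) (x + e κ) →
        ‖cj (U₀ x κ) (μ₁ (x + e κ)) - μ₁ x‖ < α₄ * ((L : ℝ) ^ j)⁻¹) →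
      (∀ x : Site d, InBox (tlo L y j) (thi L y j) x → ‖μ₂ x‖ < α₄) →
      (∀ (x : Site d) (κ : Fin d), InBox (tlo L y j) (thi L y j) x → InBox (tlo L y j) (thi L y j) (x + e κ) →
        ‖cj (U₀ x κ) (μ₂ (x + e κ)) - μ₂ x‖ < α₄ * ((L : ℝ) ^ j)⁻¹) →
      (∀ x : Site d, InBox (tlo L y j) (thi L y j) x → ‖(μ₁ - μ₂) x‖ ≤ m) →
      (∀ (x : Site d) (κ : Fin d), InBox (tlo L y j) (thi L y j) x → InBox (tlo L y j) (thi L y j) (x + e κ) →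
        ‖cj (U₀ x κ) ((μ₁ - μ₂) (x + e κ)) - (μ₁ - μ₂) x‖ ≤ m * ((L : ℝ) ^ j)⁻¹) →
      ‖Cfam j μ₁ y - Cfam j μ₂ y‖ ≤ Cl * m)
    (hCreal : ∀ j, j ≤ k → ∀ y ∈ Λs j, ∀ μ : Site d → 𝔸,
      (∀ x : Site d, InBox (tlo L y j) (thi L y j) x → ‖μ x‖ < α₄) →
      (∀ (x : Site d) (κ : Fin d), InBox (tlo L y j) (thi L y j) x → InBox (tlo L y j) (thi L y j) (x + e κ) →
        ‖cj (U₀ x κ) (μ (x + e κ)) - μ x‖ < α₄ * ((L : ℝ) ^ j)⁻¹) →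
      Cfam j (fun x => -star (μ x)) y = -star (Cfam j μ y))
    (hCbρ : Cb ≤ α₄ / (2 * B₀')) (hClB : Cl * B₀' ≤ 1 / 2)
    (th : XSpace d k 𝔸) (hτ : B₀' * ‖th‖ < α₄ / 4) (hth : ∀ p, star (th p) = -th p) :
    ∃ Hc : (Site d → 𝔸) → (Site d → 𝔸),
      (∀ s : lamSubK η U₀ L k Eb, ‖s‖ ≤ α₄ / 4 → ∀ x, ‖Hc (lamOf s) x‖ ≤ B₀' * (Cb + ‖th‖)) ∧
      (∀ s : lamSubK η U₀ L k Eb, ‖s‖ ≤ α₄ / 4 → ∀ j, j ≤ k → ∀ p ∈ Eb j,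
        wt L η j * ‖covDerivFwd η U₀ p.2 (Hc (lamOf s)) p.1‖ ≤ B₀' * (Cb + ‖th‖)) ∧
      (∀ s : lamSubK η U₀ L k Eb, ‖s‖ ≤ α₄ / 4 → Bd2 L η k Ω (covLap η U₀ (Hc (lamOf s))) (B₂' * (Cb + ‖th‖))) ∧
      (∀ s t : lamSubK η U₀ L k Eb, ‖s‖ ≤ α₄ / 4 → ‖t‖ ≤ α₄ / 4 → ∀ x,
        ‖Hc (lamOf s) x - Hc (lamOf t) x‖ ≤ (B₀' * (2 * Cl)) * ‖s - t‖) ∧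
      (∀ s t : lamSubK η U₀ L k Eb, ‖s‖ ≤ α₄ / 4 → ‖t‖ ≤ α₄ / 4 → ∀ j, j ≤ k → ∀ p ∈ Eb j,
        wt L η j * ‖covDerivFwd η U₀ p.2 (Hc (lamOf s) - Hc (lamOf t)) p.1‖ ≤ (B₀' * (2 * Cl)) * ‖s - t‖) ∧
      (∀ s t : lamSubK η U₀ L k Eb, ‖s‖ ≤ α₄ / 4 → ‖t‖ ≤ α₄ / 4 →
        Bd2 L η k Ω (covLap η U₀ (Hc (lamOf s)) - covLap η U₀ (Hc (lamOf t))) ((B₂' * (2 * Cl)) * ‖s - t‖)) ∧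
      (∀ s : lamSubK η U₀ L k Eb, ‖s‖ ≤ α₄ / 4 → (∀ x, IsSelfAdjoint (lamOf s x)) → ∀ x, IsSelfAdjoint (Hc (lamOf s) x)) ∧
      (∀ s : lamSubK η U₀ L k Eb, ‖s‖ ≤ α₄ / 4 → ∀ x, x ∉ Ω 0 → Hc (lamOf s) x = 0) ∧
      ∀ s : lamSubK η U₀ L k Eb, ‖s‖ ≤ α₄ / 4 → ∃ X : XSpace d k 𝔸,
        ‖X‖ ≤ α₄ / (2 * B₀') ∧ ‖X‖ ≤ Cb ∧
        (∀ (j : ℕ) (hj : j ≤ k) (y : Site d), y ∉ Λs j → X (⟨j, Nat.lt_succ_of_le hj⟩, y) = 0) ∧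
        (∀ (j : ℕ) (hj : j ≤ k) (y : Site d), y ∈ Λs j →
          Cfam j (((-I) • lamOf s + H' th) - H' X) y = X (⟨j, Nat.lt_succ_of_le hj⟩, y)) ∧
        Hc (lamOf s) = I • (H' th - H' X) ∧
        (-I) • (lamOf s + Hc (lamOf s)) = ((-I) • lamOf s + H' th) - H' X := by
  -- a solution with all the listed properties at each λ_s of the ball, chosen once
  have key : ∀ lam : Site d → 𝔸, ∃ X : XSpace d k 𝔸, ∀ s : lamSubK η U₀ L k Eb, lamOf s = lam → ‖s‖ ≤ α₄ / 4 →
      ‖X‖ ≤ α₄ / (2 * B₀') ∧ ‖X‖ ≤ Cb ∧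
      (∀ (j : ℕ) (hj : j ≤ k) (y : Site d), y ∉ Λs j → X (⟨j, Nat.lt_succ_of_le hj⟩, y) = 0) ∧
      ∀ (j : ℕ) (hj : j ≤ k) (y : Site d), y ∈ Λs j →
        Cfam j (((-I) • lamOf s + H' th) - H' X) y = X (⟨j, Nat.lt_succ_of_le hj⟩, y) := by
    intro lam
    by_cases h : ∃ s : lamSubK η U₀ L k Eb, lamOf s = lam ∧ ‖s‖ ≤ α₄ / 4
    · obtain ⟨s, rfl, hs⟩ := h
      obtain ⟨X, hX⟩ := familyE_exists hL hη H' hα₄ hB hCb hEbT hH0 hH1 hC121 hC125 hCbρ hClB th hτ s hs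
      refine ⟨X, fun t ht _ => ?_⟩
      rw [ext_of_lamOf ht]
      exact hX
    · exact ⟨0, fun s h1 h2 => absurd ⟨s, h1, h2⟩ h⟩
  choose Dp hDp' using key
  have hDp := fun (s : lamSubK η U₀ L k Eb) (hs : ‖s‖ ≤ α₄ / 4) => hDp' (lamOf s) s rfl hs
  -- Lipschitz and reality of the chosen map
  have hDpL : ∀ s t : lamSubK η U₀ L k Eb, ‖s‖ ≤ α₄ / 4 → ‖t‖ ≤ α₄ / 4 →
      ‖Dp (lamOf s) - Dp (lamOf t)‖ ≤ 2 * Cl * ‖s - t‖ := fun s t hs ht =>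
    familyE_lipschitz hL hη H' hB hCl hEbT hH0 hH1 hC125 hClB th hτ s t hs ht (hDp s hs).1 (hDp t ht).1 (hDp s hs).2.2.1
      (hDp s hs).2.2.2 (hDp t ht).2.2.1 (hDp t ht).2.2.2
  have hDpR : ∀ s : lamSubK η U₀ L k Eb, ‖s‖ ≤ α₄ / 4 → (∀ x, IsSelfAdjoint (lamOf s x)) → ∀ p, star (Dp (lamOf s) p) = -Dp (lamOf s) p :=
    fun s hs hsa => familyE_real hL hη H' hB hCl hEbT hH0 hH1 hHequiv hC125 hCreal hClB th hτ hth s hs hsa (hDp s hs).1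
      (hDp s hs).2.2.1 (hDp s hs).2.2.2
  -- sizes of `t̂ − D′` and of its differences
  have hbdX : ∀ s : lamSubK η U₀ L k Eb, ‖s‖ ≤ α₄ / 4 → ‖th - Dp (lamOf s)‖ ≤ Cb + ‖th‖ := fun s hs =>
    (norm_sub_le _ _).trans (by linarith [(hDp s hs).2.1])
  have hsubH : ∀ s t : lamSubK η U₀ L k Eb,
      I • (H' th - H' (Dp (lamOf s))) - I • (H' th - H' (Dp (lamOf t))) = I • H' (Dp (lamOf t) - Dp (lamOf s)) := fun s t => by
    rw [← smul_sub, map_sub]; congr 1; abel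
  have hHsub : ∀ s : lamSubK η U₀ L k Eb, H' th - H' (Dp (lamOf s)) = H' (th - Dp (lamOf s)) := fun s => by rw [map_sub]
  refine ⟨fun lam => I • (H' th - H' (Dp lam)), fun s hs x => ?_, fun s hs j hj p hp => ?_, fun s hs j hj x hx => ?_,
    fun s t hs ht x => ?_, fun s t hs ht j hj p hp => ?_, fun s t hs ht j hj x hx => ?_, fun s hs hsa x => ?_, fun s _ x hx => ?_,
    fun s hs => ?_⟩
  · -- hc0
    dsimp only
    rw [Pi.smul_apply, norm_I_smul, hHsub]
    exact (hH0 _ x).trans (mul_le_mul_of_nonneg_left (hbdX s hs) hB.le)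
  · -- hc1
    dsimp only
    rw [covDerivFwd_smul, norm_I_smul, hHsub]
    exact (hH1 j hj _ p hp).trans (mul_le_mul_of_nonneg_left (hbdX s hs) hB.le)
  · -- hc2
    dsimp only
    rw [covLap_smul, norm_I_smul, hHsub]
    exact (hH2 _ j hj x hx).trans (mul_le_mul_of_nonneg_left (hbdX s hs) hB₂)
  · -- hcL0
    dsimp only
    rw [← Pi.sub_apply, hsubH, Pi.smul_apply, norm_I_smul]
    calc ‖H' (Dp (lamOf t) - Dp (lamOf s)) x‖ ≤ B₀' * ‖Dp (lamOf t) - Dp (lamOf s)‖ := hH0 _ x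
      _ ≤ B₀' * (2 * Cl * ‖s - t‖) := by
          rw [norm_sub_rev]; exact mul_le_mul_of_nonneg_left (hDpL s t hs ht) hB.le
      _ = (B₀' * (2 * Cl)) * ‖s - t‖ := by ring
  · -- hcL1
    dsimp only
    rw [hsubH, covDerivFwd_smul, norm_I_smul]
    calc wt L η j * ‖covDerivFwd η U₀ p.2 (H' (Dp (lamOf t) - Dp (lamOf s))) p.1‖ ≤ B₀' * ‖Dp (lamOf t) - Dp (lamOf s)‖ := hH1 j hj _ p hp
      _ ≤ B₀' * (2 * Cl * ‖s - t‖) := by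
          rw [norm_sub_rev]; exact mul_le_mul_of_nonneg_left (hDpL s t hs ht) hB.le
      _ = (B₀' * (2 * Cl)) * ‖s - t‖ := by ring
  · -- hcL2
    dsimp only
    rw [Pi.sub_apply, ← covLap_sub, hsubH, covLap_smul, norm_I_smul]
    calc wt L η j ^ 2 * ‖covLap η U₀ (H' (Dp (lamOf t) - Dp (lamOf s))) x‖ ≤ B₂' * ‖Dp (lamOf t) - Dp (lamOf s)‖ :=
          hH2 _ j hj x hx
      _ ≤ B₂' * (2 * Cl * ‖s - t‖) := by
          rw [norm_sub_rev]; exact mul_le_mul_of_nonneg_left (hDpL s t hs ht) hB₂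
      _ = (B₂' * (2 * Cl)) * ‖s - t‖ := by ring
  · -- hcsa
    dsimp only
    rw [Pi.smul_apply, hHsub]
    refine isSelfAdjoint_I_smul_of_skew ?_
    have hX : ∀ p, (th - Dp (lamOf s)) p = -star ((th - Dp (lamOf s)) p) := fun p => by
      rw [BoundedContinuousFunction.coe_sub, Pi.sub_apply, star_sub, hth p, hDpR s hs hsa p]
      abel
    have h2 := congrArg star (hHequiv (th - Dp (lamOf s)) (th - Dp (lamOf s)) hX x)
    rw [star_neg, star_star] at h2
    exact h2
  · -- hcsupp
    dsimp only
    rw [Pi.smul_apply, Pi.sub_apply, hHsupp _ x hx, hHsupp _ x hx, sub_self, smul_zero]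
  · -- transfer
    refine ⟨Dp (lamOf s), (hDp s hs).1, (hDp s hs).2.1, (hDp s hs).2.2.1, (hDp s hs).2.2.2, rfl, ?_⟩
    funext x
    simp only [Pi.smul_apply, Pi.add_apply, Pi.sub_apply, smul_add, smul_sub, smul_smul]
    have hI : (-I) * I = 1 := by rw [neg_mul, Complex.I_mul_I, neg_neg]
    rw [hI, one_smul, one_smul]
    abel

end Hc

end Literature.MathematicalPhysics.QuantumFieldTheory.Balaban1983to89.B8SectEKLevelFamilyHc

end
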